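import Literature.NumberTheory.IwasawaTheory.ZpExtensionTotallyRamifiedFrom
import Literature.NumberTheory.EllipticCurves.ZpExtensionLayersLocalSymbolProofs
import HarnessLib

/-!
# Fukuda's index is `0` as soon as every ramified prime of the `ℤ_p`-tower is ramified in the FIRST layer
# (`TotallyRamifiedFrom κ 0 ⟸` «`w ∣ p` ramified in `K₁/K`»; and conversely)

Topic `Literature/NumberTheory/IwasawaTheory`, namespace `Literature.NumberTheory.IwasawaTheory` (the
namespace of `TotallyRamifiedFrom`, `ClassicalMuInvariant.lean` §5).  THEOREMS ONLY (no definition, no named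
fact, no instance; D-0026).  Sequel of `ZpExtensionTotallyRamifiedFrom.lean` (existence of SOME index `n₀`).

## What and why

Every consumer of Fukuda 1994 Thm. 1 in the tree (`fukuda1994_thm1_classNumberPExp_const_of_succ_eq_holds`,
`…classGroupPRank…_holds`, the unit-norm-index doors of `ClassicalMuVanishesUnitNormIndex*.lean`, the BSD
cells' per-curve `μ`-doors) carries Fukuda's standing hypothesis `TotallyRamifiedFrom κ n₀`, in practice with
`n₀ = 0`: every prime of `\bar ℤ_K` is unramified or TOTALLY ramified in `K_∞/K`.  So far the tree discharges
it only for `K = ℚ` (`CyclotomicRatTotallyRamified.lean`) and for `K/ℚ` Galois of degree prime to `p`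
(`Summits/…/PrintX8SmallImageTotallyRamified.lean`).  This file proves the FINITE criterion behind every
other case:

  **`TotallyRamifiedFrom κ 0` holds iff every prime of `K` above `p` that ramifies in `K_∞` is already
  ramified in the first layer `K₁ = κ.layer 1`.**

Reason (Washington, *Introduction to Cyclotomic Fields*, §13.1, proof of Lemma 13.3; Fukuda 1994 p. 264):
the image `κ(I_𝔓)` of an inertia group is a closed subgroup of `ℤ_p`, i.e. `0` or `p^e ℤ_p`
(tree `inertia_le_kerSubgroup_or_exists_layerSubgroup_le`); it is ALL of `ℤ_p` iff it is not contained
in `pℤ_p = κ(Gal(K̄/K₁))`, i.e. iff `I_𝔓` does not fix `K₁`, i.e. (Neukirch VII §10, tree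
`isUnramifiedIn_iff_forall_inertia_absRestrictNormalHom_eq_one`) iff the place is ramified in `K₁/K`.

## Main results

* `eq_top_of_layerSubgroup_le_of_not_dvd` — a subgroup of `Γ_K` containing `Gal(K̄/K_e) = κ⁻¹(p^eℤ_p)`
  and an element `g` with `p ∤ κ g` is everything (`ℤ·u + p^e ℤ_p = ℤ_p` for a unit `u`).
* **`totallyRamifiedFrom_zero_of_forall_not_le_layerSubgroup_one`** — the abstract criterion: if every
  prime `𝔓` of `\bar ℤ_K` has `I_𝔓 ≤ ker κ` or `I_𝔓 ≰ κ⁻¹(pℤ_p)`, then `TotallyRamifiedFrom κ 0`; converse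
  `not_inertia_le_layerSubgroup_of_totallyRamifiedFrom_zero`.
* `isUnramifiedIn_layer_iff_forall_inertia_le` — `w` is unramified in `K_n` iff `I_𝔓 ≤ Gal(K̄/K_n)` for all
  `𝔓 ∣ w` (Neukirch VII §10 + the Galois correspondence for the layer); one prime above `w` suffices
  (`inertia_smul_le_layerSubgroup`).
* **`totallyRamifiedFrom_zero_of_forall_not_isUnramifiedIn_layer_one`** — the finite-level criterion: if
  every `w ∣ p` of `K` is RAMIFIED in `K₁ = κ.layer 1` (`¬ Algebra.IsUnramifiedIn (𝓞 K₁) w`), then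
  `TotallyRamifiedFrom κ 0`; and `totallyRamifiedFrom_zero_of_forall_isUnramifiedIn_or_not` — the sharp
  form allowing primes above `p` that are unramified in the whole tower.
* `not_isUnramifiedIn_layer_one_of_totallyRamifiedFrom_zero` — converse: under `TotallyRamifiedFrom κ 0` a
  place ramified in some layer `K_n` is ramified in `K₁`.

No elliptic curve occurs here; BSD is not advanced by this file.  Consumers: the `p = 2` parity criterion
`CyclotomicTwoTotallyRamifiedOddIndex.lean` (cell `bsd-2adic`, crux C1″ of K4) and every Fukuda door.

References: [Washington1997] §13.1, Prop. 13.2 and Lemma 13.3 (proof); [Fukuda1994] p. 264 (the index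
`n₀`); [NeukirchANT1999] Ch. VII §10, proof of (10.6) (`𝔭` ramified iff `I_𝔓 ≠ 1` in `Gal(L/K)`).
-/

noncomputable section

open scoped NumberField Pointwise
open Multiplicative

namespace Literature.NumberTheory.IwasawaTheory

open Literature.NumberTheory.EllipticCurves Literature.NumberTheory.GaloisRepresentations Field
  IsDedekindDomain NumberField

variable {K : Type} [Field K] [NumberField K] {p : ℕ} [Fact p.Prime]

/-! ## §1 The abstract criterion: `κ(I_𝔓) ⊄ pℤ_p` forces `κ(I_𝔓) = ℤ_p` -/

omit [NumberField K] in
/-- **A subgroup `H ≤ Γ_K` containing `Gal(K̄/K_e) = κ⁻¹(p^e ℤ_p)` and some `g` with `p ∤ κ g` is all of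
`Γ_K`**: `κ g = u` is a unit of `ℤ_p`, so for every `σ` there is `m ∈ ℕ` with `κ σ ≡ m u (mod p^e)`
(`ℤ_p/p^e = ℤ/p^e`, `PadicInt.toZModPow`), whence `σ = g^m · (g^{-m} σ)` with `g^{-m}σ ∈ κ⁻¹(p^eℤ_p) ≤ H`.
[cite: Washington1997, §13.1 (proof of Lemma 13.3)] -/
theorem eq_top_of_layerSubgroup_le_of_not_dvd (κ : ZpExtension K p) {H : Subgroup (absoluteGaloisGroup K)}
    {e : ℕ} (he : κ.layerSubgroup e ≤ H) {g : absoluteGaloisGroup K} (hg : g ∈ H)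
    (hndvd : ¬ (p : ℤ_[p]) ∣ toAdd (κ g)) : H = ⊤ := by
  classical
  rw [eq_top_iff]
  intro σ _
  set u : ℤ_[p] := toAdd (κ g) with hu
  set x : ℤ_[p] := toAdd (κ σ) with hx
  -- `u` is a unit of `ℤ_p`
  have hunit : IsUnit u := by
    rw [PadicInt.isUnit_iff]
    have hle : ‖u‖ ≤ 1 := PadicInt.norm_le_one u
    have hlt : ¬ ‖u‖ < 1 := fun h => hndvd ((PadicInt.norm_lt_one_iff_dvd u).mp h)
    exact le_antisymm hle (not_lt.mp hlt)
  -- choose `m` with `x ≡ m u (mod p^e)`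
  obtain ⟨v, hv⟩ := hunit.map (PadicInt.toZModPow e)
  set m : ℕ := ((PadicInt.toZModPow e x) * ((v⁻¹ : (ZMod (p ^ e))ˣ) : ZMod (p ^ e))).val with hm
  have hmod : (p : ℤ_[p]) ^ e ∣ x - (m : ℤ_[p]) * u := by
    rw [← Ideal.mem_span_singleton, ← PadicInt.ker_toZModPow, RingHom.mem_ker, map_sub, map_mul,
      map_natCast, hm, ZMod.natCast_zmod_val, ← hv, mul_assoc, Units.inv_mul, mul_one, sub_self]
  -- `g^{-m} σ ∈ κ⁻¹(p^e ℤ_p)`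
  have hmem : (g ^ m)⁻¹ * σ ∈ κ.layerSubgroup e := by
    rw [ZpExtension.mem_layerSubgroup, map_mul, map_inv, map_pow, toAdd_mul, toAdd_inv, toAdd_pow,
      nsmul_eq_mul]
    have : -( (m : ℤ_[p]) * u) + x = x - (m : ℤ_[p]) * u := by ring
    rw [this]
    exact hmod
  have hσ : σ = g ^ m * ((g ^ m)⁻¹ * σ) := by group
  rw [hσ]
  exact H.mul_mem (H.pow_mem hg m) (he hmem)

omit [NumberField K] in
/-- `I_𝔓 ≤ Gal(K̄/K_n)` iff `I_𝔓 · Gal(K̄/K_∞) ≤ Gal(K̄/K_n)` (as `ker κ ≤ κ⁻¹(pⁿℤ_p)`): containment in a layer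
subgroup only depends on the image of the inertia group in the abelian group `Gal(K_∞/K)`. [folklore]
[cite: Washington1997, §13.1] -/
theorem inertia_le_layerSubgroup_iff_sup_le (κ : ZpExtension K p) (n : ℕ)
    (𝔓 : Ideal (absIntegers (𝓞 K) K)) :
    𝔓.inertia (absoluteGaloisGroup K) ≤ κ.layerSubgroup n ↔
      𝔓.inertia (absoluteGaloisGroup K) ⊔ κ.kerSubgroup ≤ κ.layerSubgroup n :=
  ⟨fun h => sup_le h (κ.kerSubgroup_le_layerSubgroup n), fun h => le_sup_left.trans h⟩

omit [NumberField K] in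
/-- Containment `I_𝔓 ≤ Gal(K̄/K_n)` is the same for all `Γ_K`-conjugates of `𝔓` (the inertia groups of
conjugate primes agree modulo `ker κ`, tree `inertia_smul_sup_kerSubgroup`). [cite: Washington1997, §13.1 (proof of Lemma 13.3)] -/
theorem inertia_smul_le_layerSubgroup (κ : ZpExtension K p) (n : ℕ) (𝔓 : Ideal (absIntegers (𝓞 K) K))
    (τ : absoluteGaloisGroup K) (h : 𝔓.inertia (absoluteGaloisGroup K) ≤ κ.layerSubgroup n) :
    (τ • 𝔓).inertia (absoluteGaloisGroup K) ≤ κ.layerSubgroup n := by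
  rw [inertia_le_layerSubgroup_iff_sup_le] at h ⊢
  rwa [inertia_smul_sup_kerSubgroup κ 𝔓 τ]

/-- **Abstract criterion for Fukuda's index `0`.**  If every prime `𝔓` of `\bar ℤ_K` (above a finite place)
either has `I_𝔓 ≤ Gal(K̄/K_∞)` (unramified in the tower) or `I_𝔓 ≰ Gal(K̄/K₁) = κ⁻¹(pℤ_p)` (does not fix the
first layer), then every ramified prime is totally ramified in `K_∞/K`: `TotallyRamifiedFrom κ 0`.  Proof:
`κ(I_𝔓)` is closed, hence `⊇ p^e ℤ_p` for some `e` when non-trivial (tree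
`inertia_le_kerSubgroup_or_exists_layerSubgroup_le`); with an element of unit image it is everything
(`eq_top_of_layerSubgroup_le_of_not_dvd`). [cite: Washington1997, §13.1 (proof of Lemma 13.3)]
[cite: Fukuda1994, p. 264] -/
theorem totallyRamifiedFrom_zero_of_forall_not_le_layerSubgroup_one (κ : ZpExtension K p)
    (h : ∀ (w : HeightOneSpectrum (𝓞 K)) (𝔓 : Ideal (absIntegers (𝓞 K) K)), 𝔓 ∈ w.primesAbove →
      𝔓.inertia (absoluteGaloisGroup K) ≤ κ.kerSubgroup ∨
        ¬ 𝔓.inertia (absoluteGaloisGroup K) ≤ κ.layerSubgroup 1) :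
    TotallyRamifiedFrom κ 0 := by
  rw [totallyRamifiedFrom_zero_iff]
  intro w 𝔓 h𝔓
  rcases h w 𝔓 h𝔓 with hle | hnot
  · exact Or.inl hle
  · right
    rcases inertia_le_kerSubgroup_or_exists_layerSubgroup_le κ 𝔓 with hle | ⟨e, he⟩
    · exact absurd (hle.trans (κ.kerSubgroup_le_layerSubgroup 1)) hnot
    · obtain ⟨g, hgI, hg1⟩ := SetLike.not_le_iff_exists.mp hnot
      rw [ZpExtension.mem_layerSubgroup, pow_one] at hg1
      exact eq_top_of_layerSubgroup_le_of_not_dvd κ he (Subgroup.mem_sup_left hgI) hg1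

omit [NumberField K] in
/-- **Converse.**  Under `TotallyRamifiedFrom κ 0`, a prime `𝔓` ramified in the tower (`I_𝔓 ≰ Gal(K̄/K_∞)`)
does not fix any layer `K_n`, `n ≠ 0`: `I_𝔓 ≰ κ⁻¹(pⁿℤ_p)` (else `Γ_K = I_𝔓 · ker κ ≤ κ⁻¹(pⁿℤ_p)`, a subgroup
of index `pⁿ > 1`, `ZpExtension.index_layerSubgroup`). [cite: Fukuda1994, p. 264] -/
theorem not_inertia_le_layerSubgroup_of_totallyRamifiedFrom_zero (κ : ZpExtension K p)
    (h : TotallyRamifiedFrom κ 0) {w : HeightOneSpectrum (𝓞 K)} {𝔓 : Ideal (absIntegers (𝓞 K) K)}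
    (h𝔓 : 𝔓 ∈ w.primesAbove) (hram : ¬ 𝔓.inertia (absoluteGaloisGroup K) ≤ κ.kerSubgroup) {n : ℕ}
    (hn : n ≠ 0) : ¬ 𝔓.inertia (absoluteGaloisGroup K) ≤ κ.layerSubgroup n := by
  intro hle
  rw [totallyRamifiedFrom_zero_iff] at h
  rcases h w 𝔓 h𝔓 with h1 | h1
  · exact hram h1
  · have htop : κ.layerSubgroup n = ⊤ :=
      top_le_iff.mp (h1.ge.trans (sup_le hle (κ.kerSubgroup_le_layerSubgroup n)))
    have hidx := κ.index_layerSubgroup n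
    rw [htop, Subgroup.index_top] at hidx
    exact (Nat.one_lt_pow hn (Fact.out : p.Prime).one_lt).ne hidx

/-! ## §2 The finite-level criterion: ramification in the first layer -/

/-- **`w` is unramified in the layer `K_n` iff every inertia group above `w` fixes `K_n`**, i.e.
`I_𝔓 ≤ κ⁻¹(pⁿℤ_p)` for all primes `𝔓 ∣ w` of `\bar ℤ_K` («`𝔭` is unramified in `L` iff `I_𝔓` dies in
`Gal(L/K)`», Neukirch VII §10, tree `isUnramifiedIn_iff_forall_inertia_absRestrictNormalHom_eq_one`, plus the
Galois correspondence for the layer, tree `ZpExtension.absRestrictNormalHom_layer_eq_one_iff`).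
[cite: NeukirchANT1999, Ch. VII §10 Thm. (10.6) (proof)] [cite: Washington1997, §13.1] -/
theorem isUnramifiedIn_layer_iff_forall_inertia_le (κ : ZpExtension K p) (n : ℕ)
    (w : HeightOneSpectrum (𝓞 K)) :
    Algebra.IsUnramifiedIn (𝓞 (κ.layer n)) w.asIdeal ↔
      ∀ 𝔓 ∈ w.primesAbove, 𝔓.inertia (absoluteGaloisGroup K) ≤ κ.layerSubgroup n := by
  haveI : FiniteDimensional K (κ.layer n) := κ.finiteDimensional_layer_holds n
  haveI : IsGalois K (κ.layer n) := κ.isGalois_layer_holds n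
  rw [NumberFields.isUnramifiedIn_iff_forall_inertia_absRestrictNormalHom_eq_one]
  refine forall₂_congr fun 𝔓 _ => forall₂_congr fun g _ => ?_
  exact κ.absRestrictNormalHom_layer_eq_one_iff n g

/-- One prime above `w` suffices: `w` is unramified in `K_n` iff `I_𝔓 ≤ κ⁻¹(pⁿℤ_p)` for ONE prime `𝔓 ∣ w`
of `\bar ℤ_K` (the primes above `w` are `Γ_K`-conjugate, tree `exists_smul_eq_of_mem_primesAbove_holds`,
and containment is conjugation-invariant, `inertia_smul_le_layerSubgroup`).
[cite: NeukirchANT1999, Ch. I §9 Prop. (9.1)] [cite: Washington1997, §13.1] -/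
theorem isUnramifiedIn_layer_iff_inertia_le (κ : ZpExtension K p) (n : ℕ) {w : HeightOneSpectrum (𝓞 K)}
    {𝔓 : Ideal (absIntegers (𝓞 K) K)} (h𝔓 : 𝔓 ∈ w.primesAbove) :
    Algebra.IsUnramifiedIn (𝓞 (κ.layer n)) w.asIdeal ↔
      𝔓.inertia (absoluteGaloisGroup K) ≤ κ.layerSubgroup n := by
  rw [isUnramifiedIn_layer_iff_forall_inertia_le]
  refine ⟨fun h => h 𝔓 h𝔓, fun h 𝔓' h𝔓' => ?_⟩
  obtain ⟨τ, rfl⟩ := HeightOneSpectrum.exists_smul_eq_of_mem_primesAbove_holds (v := w) h𝔓 h𝔓'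
  exact inertia_smul_le_layerSubgroup κ n 𝔓 τ h

/-- **Fukuda's index is `0` when every prime above `p` is ramified in the first layer.**  For a
`ℤ_p`-extension `κ` of a number field `K`: if every place `w ∣ p` of `K` is RAMIFIED in `K₁ = κ.layer 1`
(`¬ Algebra.IsUnramifiedIn (𝓞 K₁) w`), then every prime of `\bar ℤ_K` is unramified or totally ramified in
`K_∞/K` — `TotallyRamifiedFrom κ 0` (places `w ∤ p` are unramified in the tower, tree
`ZpExtension.inertia_le_kerSubgroup_holds`, Washington Prop. 13.2).  This is the hypothesis `hram`/`hκ` of the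
tree's Fukuda doors at `n₀ = 0`, reduced to a statement about ONE finite layer.
[cite: Washington1997, §13.1 Prop. 13.2 and Lemma 13.3 (proof)] [cite: Fukuda1994, p. 264] -/
theorem totallyRamifiedFrom_zero_of_forall_not_isUnramifiedIn_layer_one (κ : ZpExtension K p)
    (h : ∀ w : HeightOneSpectrum (𝓞 K), ((p : ℕ) : 𝓞 K) ∈ w.asIdeal →
      ¬ Algebra.IsUnramifiedIn (𝓞 (κ.layer 1)) w.asIdeal) :
    TotallyRamifiedFrom κ 0 := by
  refine totallyRamifiedFrom_zero_of_forall_not_le_layerSubgroup_one κ fun w 𝔓 h𝔓 => ?_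
  by_cases hpw : ((p : ℕ) : 𝓞 K) ∈ w.asIdeal
  · exact Or.inr fun hle => h w hpw ((isUnramifiedIn_layer_iff_inertia_le κ 1 h𝔓).mpr hle)
  · exact Or.inl (ZpExtension.inertia_le_kerSubgroup_holds K p κ hpw h𝔓)

/-- **Sharp form.**  `TotallyRamifiedFrom κ 0` holds as soon as every place `w ∣ p` of `K` is EITHER
unramified in the whole tower (all `I_𝔓 ≤ Gal(K̄/K_∞)`, `𝔓 ∣ w`) OR ramified in the first layer `K₁`.
[cite: Washington1997, §13.1 Prop. 13.2 and Lemma 13.3 (proof)] [cite: Fukuda1994, p. 264] -/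
theorem totallyRamifiedFrom_zero_of_forall_isUnramifiedIn_or_not (κ : ZpExtension K p)
    (h : ∀ w : HeightOneSpectrum (𝓞 K), ((p : ℕ) : 𝓞 K) ∈ w.asIdeal →
      (∀ 𝔓 ∈ w.primesAbove, 𝔓.inertia (absoluteGaloisGroup K) ≤ κ.kerSubgroup) ∨
        ¬ Algebra.IsUnramifiedIn (𝓞 (κ.layer 1)) w.asIdeal) :
    TotallyRamifiedFrom κ 0 := by
  refine totallyRamifiedFrom_zero_of_forall_not_le_layerSubgroup_one κ fun w 𝔓 h𝔓 => ?_
  by_cases hpw : ((p : ℕ) : 𝓞 K) ∈ w.asIdeal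
  · rcases h w hpw with hker | hram
    · exact Or.inl (hker 𝔓 h𝔓)
    · exact Or.inr fun hle => hram ((isUnramifiedIn_layer_iff_inertia_le κ 1 h𝔓).mpr hle)
  · exact Or.inl (ZpExtension.inertia_le_kerSubgroup_holds K p κ hpw h𝔓)

/-- **Converse at finite level.**  Under `TotallyRamifiedFrom κ 0`, a place of `K` ramified in SOME layer
`K_n` is ramified in the first layer `K₁` (its inertia groups are not in `ker κ`, hence not in `κ⁻¹(pℤ_p)`,
`not_inertia_le_layerSubgroup_of_totallyRamifiedFrom_zero`). [cite: Fukuda1994, p. 264]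
[cite: Washington1997, §13.1] -/
theorem not_isUnramifiedIn_layer_one_of_totallyRamifiedFrom_zero (κ : ZpExtension K p)
    (h : TotallyRamifiedFrom κ 0) {w : HeightOneSpectrum (𝓞 K)} {n : ℕ}
    (hn : ¬ Algebra.IsUnramifiedIn (𝓞 (κ.layer n)) w.asIdeal) :
    ¬ Algebra.IsUnramifiedIn (𝓞 (κ.layer 1)) w.asIdeal := by
  rw [isUnramifiedIn_layer_iff_forall_inertia_le] at hn ⊢
  push Not at hn
  obtain ⟨𝔓, h𝔓, hnot⟩ := hn
  intro hall
  have hram : ¬ 𝔓.inertia (absoluteGaloisGroup K) ≤ κ.kerSubgroup :=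
    fun hle => hnot (hle.trans (κ.kerSubgroup_le_layerSubgroup n))
  exact not_inertia_le_layerSubgroup_of_totallyRamifiedFrom_zero κ h h𝔓 hram one_ne_zero (hall 𝔓 h𝔓)

end Literature.NumberTheory.IwasawaTheory

end
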